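import Literature.NumberTheory.Automorphic.Qian2022PotentialAutomorphy
import HarnessLib

/-!
# Soluble descent of automorphy for `GL_n` over CM / totally real fields
(Allen–Calegari–Caraiani–Gee–Helm–Le Hung–Newton–Scholze–Taylor–Thorne 2023, Prop. 6.5.13 (2))

Topic `NumberTheory/Automorphic`; vocabulary of `Qian2022PotentialAutomorphy`
(`Qian2022.IsAutomorphic ι r`: "`r ≅ r_ι(π)` for a regular algebraic cuspidal `π` of
`GL_n(𝔸_K)`", rendered as "`r` is semisimple and has the characterising property of `r_ι(π)`"),
`FramedGaloisRep.restrictField` (`GaloisRep.lean`), Mathlib `NumberField.IsCMField`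
(= "imaginary CM": totally complex quadratic extension of its maximal real subfield),
`NumberField.IsTotallyReal`, `IsGalois`, `IsSolvable (E ≃ₐ[F] E)`.

P. Allen, F. Calegari, A. Caraiani, T. Gee, D. Helm, B. Le Hung, J. Newton, P. Scholze,
R. Taylor, J. Thorne, *Potential automorphy over CM fields*, Ann. of Math. 197 (2023) 897–1113
(= arXiv:1812.09999), **Proposition 6.5.13** (numbered "Proposition 124" in the held arXiv text,
§6.5, read 2026-08-16), as printed:

> Fix an integer `n ≥ 2`, a prime `p`, and an isomorphism `ι : ℚ̄_p → ℂ`. Let `F` be an imaginary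
> CM or totally real number field, and let `E / F` be finite Galois extension such that
> `Gal(E/F)` is soluble and `E` is also imaginary CM or totally real. Then:
> (1) Let `π` be a cuspidal, regular algebraic automorphic representation of `GL_n(𝔸_F)` of weight
> `λ`. Suppose that `r_ι(π)|_{G_E}` is irreducible. Then there exists a cuspidal, regular algebraic
> automorphic representation `π_E` of `GL_n(𝔸_E)` of weight `λ_{E,τ} = λ_{τ|_E}` such that
> `r_ι(π_E) ≅ r_ι(π)|_{G_E}`. […]
> (2) Let `ρ : G_F → GL_n(ℚ̄_p)` be a continuous representation such that `ρ|_{G_E}` is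
> irreducible. Suppose that there exists a cuspidal, regular algebraic automorphic representation
> `π` of `GL_n(𝔸_E)` of weight `λ` such that `ρ|_{G_E} ≅ r_ι(π)`. Define `λ_F` by
> `λ_{F,τ} = λ_{τ'}` […]. Then `λ_F` is independent of any choices, and there exists a cuspidal,
> regular algebraic automorphic representation `π_F` of `GL_n(𝔸_F)` of weight `λ_F` such that
> `ρ ≅ r_ι(π_F)`. If `w` is a finite place of `E` lying above the place `v` of `F`, then we have
> `rec_{E_w}(π) = rec_{F_v}(π_F)`.

Printed proof: induction to `E/F` cyclic of prime degree; `π^σ ≅ π` by strong multiplicity one;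
cyclic base change / descent of Arthur–Clozel ([MR1007299], Ch. 3, Thm. 4.2 and Thm. 5.1);
Chebotarev; the twist `Π ⊗ (η ∘ Art_F⁻¹)^i` is selected through `r_ι` (the Galois
representations of Harris–Lan–Taylor–Thorne attached to regular algebraic cuspidal `π` over CM
fields).  None of these inputs is a theorem of the tree: NAMED FACT (D-0014).

## What is vendored, and for whom

* `ACC2023.solubleDescent_isAutomorphic` — part **(2)** with the weight clause and the local
  clause `rec_{E_w}(π) = rec_{F_v}(π_F)` DROPPED (weaker than print, never stronger): if `ρ|_{Γ_E}`
  is irreducible and automorphic in Qian's sense (`Qian2022.IsAutomorphic ι (ρ.restrictField E)`,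
  i.e. `≅ r_ι(π)` for some regular algebraic cuspidal `π` of `GL_n(𝔸_E)`), then `ρ` is automorphic
  (`Qian2022.IsAutomorphic ι ρ`).
* `ACC2023.solubleBaseChange_isAutomorphic` — part **(1)** in the same vocabulary: if `ρ` is
  automorphic and `ρ|_{Γ_E}` is irreducible then `ρ|_{Γ_E}` is automorphic (weight clause and local
  clause dropped).

The tree so far held (2) only for the Tate modules of elliptic curves
(`exists_isCMField_forall_isSolvable_isTateAutomorphic`, `Sweep1PotentialModularitySolubleDescent`).
The general-rank form grounds the "STRONGLY potentially automorphic" clause — automorphy of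
`σ|_{Γ_E}` for every intermediate `K ⊆ E ⊆ F'` with `F'/E` soluble — of
`Summit.Langlands.Langlands.Theses.OrdinaryPrimeTransport.SummandsPotentiallyAutomorphic`
(item stmt-Langlands-17210), exactly as BLGGT 2014 (proof of Thm. 5.4.2) and Patrikis–Taylor
2015 pass from potential automorphy over `F'` to every soluble-index subfield via BLGHT Lemma 1.4,
and is the descent half of the Rankin–Selberg pole count `…OrdinaryPrimeTransport.RankinSelbergPoleCount`
(stmt-Langlands-17212).  NOTE for consumers: an intermediate field of a CM Galois extension
`F'/K` containing the CM or totally real `K` is again CM or totally real (complex conjugation is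
central in `Gal`), which is the hypothesis `hE` below; and the route's compatibility predicate
`Summit.Langlands.SatakeFrobCompatibleAt` is a different rendering of "`≅ r_ι(π)` a.e." from
`Qian2022.IsCompatible` — the glue between the two is NOT part of this fact.

## References

* [AllenCalegariCaraianiGeeEtAl2023] P. Allen et al., *Potential automorphy over CM fields*,
  Ann. of Math. 197 (2023), Prop. 6.5.13 (held: arXiv:1812.09999, §6.5 "Proposition 124",
  pp. 87–88 of the held text, read 2026-08-16).
* [ArthurClozelAMS120] J. Arthur, L. Clozel, *Simple algebras, base change, and the advanced
  theory of the trace formula*, Ch. 3, Thm. 4.2 and Thm. 5.1.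
* [HarrisLanTaylorThorneRMS2016] M. Harris, K.-W. Lan, R. Taylor, J. Thorne, *On the rigid
  cohomology of certain Shimura varieties*, Res. Math. Sci. 3:37 (2016), Thm. A.
-/

noncomputable section

open scoped NumberField
open NumberField Field
open Literature.NumberTheory.GaloisRepresentations

namespace Literature.NumberTheory.Automorphic

namespace ACC2023

/-- **ACC+ 2023, Prop. 6.5.13 (2) — soluble descent of automorphy**, NAMED FACT.  For every
`n ≥ 2`, prime `p`, `ι : ℚ̄_p ≃ ℂ`, every number field `F` which is totally real or (imaginary) CM,
every finite Galois extension `E/F` with `Gal(E/F)` soluble and `E` again totally real or CM, and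
every continuous `ρ : Γ_F → GL_n(ℚ̄_p)`: if `ρ|_{Γ_E}` is irreducible and `ρ|_{Γ_E} ≅ r_ι(π)` for
some cuspidal regular algebraic `π` of `GL_n(𝔸_E)` (`Qian2022.IsAutomorphic ι (ρ.restrictField E)`),
then `ρ ≅ r_ι(π_F)` for some cuspidal regular algebraic `π_F` of `GL_n(𝔸_F)`
(`Qian2022.IsAutomorphic ι ρ`).  The printed weight clause (`π_F` of weight `λ_F`) and local clause
(`rec_{E_w}(π) = rec_{F_v}(π_F)`) are dropped: weaker than print.  Grounds the "strongly
potentially automorphic" clause of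
`Summit.Langlands.Langlands.Theses.OrdinaryPrimeTransport.SummandsPotentiallyAutomorphic`.
[cite: AllenCalegariCaraianiGeeEtAl2023, Prop. 6.5.13 (2)] -/
def solubleDescent_isAutomorphic : Prop :=
  ∀ (n : ℕ), 2 ≤ n →
    ∀ (p : ℕ) [Fact p.Prime] (ι : PadicAlgCl p ≃+* ℂ)
      (F : Type) [Field F] [NumberField F], (IsTotallyReal F ∨ IsCMField F) →
    ∀ (E : Type) [Field E] [NumberField E] [Algebra F E],
      IsGalois F E → IsSolvable (E ≃ₐ[F] E) → (IsTotallyReal E ∨ IsCMField E) →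
    ∀ (ρ : FramedGaloisRep F (PadicAlgCl p) n),
      (ρ.restrictField E).toGaloisRep.IsIrreducible →
      Qian2022.IsAutomorphic ι (ρ.restrictField E) →
        Qian2022.IsAutomorphic ι ρ

/-- **ACC+ 2023, Prop. 6.5.13 (1) — soluble base change of automorphy**, NAMED FACT, same
setting: if `ρ ≅ r_ι(π)` for a cuspidal regular algebraic `π` of `GL_n(𝔸_F)`
(`Qian2022.IsAutomorphic ι ρ`) and `ρ|_{Γ_E}` is irreducible, then `ρ|_{Γ_E} ≅ r_ι(π_E)` for a
cuspidal regular algebraic `π_E` of `GL_n(𝔸_E)` (`Qian2022.IsAutomorphic ι (ρ.restrictField E)`).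
Printed: "Suppose that `r_ι(π)|_{G_E}` is irreducible. Then there exists a cuspidal, regular
algebraic automorphic representation `π_E` of `GL_n(𝔸_E)` of weight `λ_{E,τ} = λ_{τ|_E}` such that
`r_ι(π_E) ≅ r_ι(π)|_{G_E}`" — applied to `ρ ≅ r_ι(π)`; weight and local clauses dropped (weaker
than print).
[cite: AllenCalegariCaraianiGeeEtAl2023, Prop. 6.5.13 (1)] -/
def solubleBaseChange_isAutomorphic : Prop :=
  ∀ (n : ℕ), 2 ≤ n →
    ∀ (p : ℕ) [Fact p.Prime] (ι : PadicAlgCl p ≃+* ℂ)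
      (F : Type) [Field F] [NumberField F], (IsTotallyReal F ∨ IsCMField F) →
    ∀ (E : Type) [Field E] [NumberField E] [Algebra F E],
      IsGalois F E → IsSolvable (E ≃ₐ[F] E) → (IsTotallyReal E ∨ IsCMField E) →
    ∀ (ρ : FramedGaloisRep F (PadicAlgCl p) n),
      Qian2022.IsAutomorphic ι ρ →
      (ρ.restrictField E).toGaloisRep.IsIrreducible →
        Qian2022.IsAutomorphic ι (ρ.restrictField E)

/-- Soluble descent along a tower: under `solubleDescent_isAutomorphic`, automorphy descends from
`E` to `F` through any presentation of the hypotheses (restatement with the instance binders made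
explicit arguments, convenient for `obtain`). [cite: AllenCalegariCaraianiGeeEtAl2023, Prop. 6.5.13 (2)] -/
theorem isAutomorphic_of_restrictField (h : solubleDescent_isAutomorphic)
    {n : ℕ} (hn : 2 ≤ n) {p : ℕ} [Fact p.Prime] (ι : PadicAlgCl p ≃+* ℂ)
    {F : Type} [Field F] [NumberField F] (hF : IsTotallyReal F ∨ IsCMField F)
    (E : Type) [Field E] [NumberField E] [Algebra F E] [IsGalois F E]
    (hsol : IsSolvable (E ≃ₐ[F] E)) (hE : IsTotallyReal E ∨ IsCMField E)
    (ρ : FramedGaloisRep F (PadicAlgCl p) n)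
    (hirr : (ρ.restrictField E).toGaloisRep.IsIrreducible)
    (haut : Qian2022.IsAutomorphic ι (ρ.restrictField E)) :
    Qian2022.IsAutomorphic ι ρ :=
  h n hn p ι F hF E ‹IsGalois F E› hsol hE ρ hirr haut

end ACC2023

end Literature.NumberTheory.Automorphic
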